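import Mathlib
import Summits.NavierStokesRegularity.NavierStokesRegularity.Theorems.BarrierStepRungThreeDefs
import Summits.NavierStokesRegularity.NavierStokesRegularity.Theorems.BarrierStepRungThreeTriggerWindowField
import HarnessLib

/-!
# `BarrierStepRungThree`, LINE g2-2 (re-instanced): the lattice identity and the decrease adapter
instantiated with the route's definitions `TriggerWindow.point` / `TriggerWindow.field`

`Theorems/BarrierStepRungThreeTriggerWindowField.lean` states the lattice identity and the
`sdp2lean` adapter with the evaluation point and the field given by defining equations; this file
discharges those equations for the definitions of `Theorems/BarrierStepRungThreeDefs.lean`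
(`TriggerWindow.point`, `TriggerWindow.field`), so certificate files can use the definitions
directly. HONEST FRAMING: bookkeeping for a MODEL lattice table (class rung TL-M3); nothing here is
about the Navier–Stokes equations; no item is closed.
-/

noncomputable section

-- the sub-problem namespace `Summit.NavierStokesRegularity.NavierStokesRegularity` repeats the summit name by design (D-0017)
set_option linter.dupNamespace false

namespace Summit.NavierStokesRegularity.NavierStokesRegularity.Theorems

namespace TriggerWindow

open Finset
open Literature.Analysis.FluidPDE Literature.Analysis.FluidPDE.TaoCascade
open Literature.Computation.Certificates Literature.Computation.Certificates.SOS
open Literature.Computation.Certificates.SOS.Poly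

/-- `point S` reads the window {−1,0,1} at index `4j+i`. [this file] -/
theorem point_window (S : Fin 4 → ℤ → ℝ) (i : Fin 4) (j : Fin 3) :
    point S (4 * (j : ℕ) + (i : ℕ)) = S i (-1 + (j : ℕ)) := by
  fin_cases i <;> fin_cases j <;> rfl

/-- `point S` reads the boundary shell `−2` at index `12+i`. [this file] -/
theorem point_below (S : Fin 4 → ℤ → ℝ) (i : Fin 4) : point S (12 + (i : ℕ)) = S i (-2) := by
  fin_cases i <;> rfl

/-- `point S` reads the boundary shell `2` at index `16+i`. [this file] -/
theorem point_above (S : Fin 4 → ℤ → ℝ) (i : Fin 4) : point S (16 + (i : ℕ)) = S i 2 := by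
  fin_cases i <;> rfl

/-- `point S 20 = √2`. [this file] -/
theorem point_twenty (S : Fin 4 → ℤ → ℝ) : point S 20 = Real.sqrt 2 := rfl

section Pencil

variable (τ α₀ τ' σ : Fin 4 → Fin 4 → Fin 4 → ℤ × ℤ × ℤ → ℝ)
  (hτ : τ = fun (a b c : Fin 4) (μ : ℤ × ℤ × ℤ) => if a = 0 ∧ b = 1 ∧ c = 1 then
    (if μ = (0, 0, 0) then (1 : ℝ) / 2 else if μ = (1, 0, 0) then -(1 / 2) else 0) else 0)
  (hα₀ : α₀ = fun (a b c : Fin 4) (μ : ℤ × ℤ × ℤ) => τ a b c μ - τ c b a (μ.2.2, μ.2.1, μ.1) +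
    τ b a c (μ.2.1, μ.1, μ.2.2) - τ c a b (μ.2.2, μ.1, μ.2.1))
  (hτ' : τ' = fun (a b c : Fin 4) (μ : ℤ × ℤ × ℤ) => if a = 0 ∧ b = 1 ∧ c = 1 then
    (if μ = (0, 0, 1) then (1 : ℝ) / 2 else 0) else 0)
  (hσ : σ = fun (a b c : Fin 4) (μ : ℤ × ℤ × ℤ) => τ' a b c μ - τ' c b a (μ.2.2, μ.2.1, μ.1) +
    τ' b a c (μ.2.1, μ.1, μ.2.2) - τ' c a b (μ.2.2, μ.1, μ.2.1))

include hτ hα₀ hτ' hσ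

/-- **Lattice identity with the route's definitions**: the window restriction of the `ε₀ = 1`
cascade nonlinearity of the pencil `α₀ + βσ` at `S` is `(field β)[4j+i]` evaluated at `point S`.
[cite: Tao2016AveragedNS, §4 (4.8); tree `TriggerWindow.quadTerm_pencil_window_eq_eval_field`] -/
theorem quadTerm_pencil_window_eq_eval_field_point (β : ℚ) (S : Fin 4 → ℤ → ℝ) (i : Fin 4)
    (j : Fin 3) :
    quadTerm 1 (fun a b c μ => α₀ a b c μ + (β : ℝ) * σ a b c μ) (fun i' k' (_ : ℝ) => S i' k') i
        (-1 + (j : ℕ)) 0 =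
      Poly.eval (point S) ((field β).getD (4 * (j : ℕ) + (i : ℕ)) []) :=
  quadTerm_pencil_window_eq_eval_field τ α₀ τ' σ hτ hα₀ hτ' hσ β (field β) rfl point point_window
    point_below point_above point_twenty S i j

/-- **Decrease adapter with the route's definitions** (`kLo := -1`, `n := 3`): an `sdp2lean`-shaped
bound `(lieDeriv (field β) P)(y) ≤ m` on the box {`y₂₀² = 2`, `y₂₀ ≥ 0`, `P ≤ 0`, `G > 0`, window
caps, boundary caps} yields the hypothesis `hdec` of `WindowBox.decrease_of_box(_le)` for the clock
`v x := P.eval (L x)` and goal `g x := G.eval (L x)`. [tree `TriggerWindow.decrease_box_of_sos`] -/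
theorem decrease_box_of_sos_field (β : ℚ) (P G : Poly) (hP : numVars P ≤ 12) (hG : numVars G ≤ 12)
    (L : (Fin 4 → Fin 3 → ℝ) →L[ℝ] (ℕ → ℝ))
    (hL : ∀ (x : Fin 4 → Fin 3 → ℝ) (i : Fin 4) (j : Fin 3), L x (4 * (j : ℕ) + (i : ℕ)) = x i j)
    {q : ℤ → ℝ} {Φ : Fin 4 → Fin 3 → ℝ} {m : ℝ}
    (hsos : ∀ y : ℕ → ℝ, y 20 * y 20 = 2 → 0 ≤ y 20 → (Poly.eval y P : ℝ) ≤ 0 → 0 < (Poly.eval y G : ℝ) →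
      (∀ (i : Fin 4) (j : Fin 3), y (4 * (j : ℕ) + (i : ℕ)) ^ 2 ≤ 2 * Φ i j) →
      (∀ i : Fin 4, |y (12 + (i : ℕ))| ≤ q (-2)) → (∀ i : Fin 4, |y (16 + (i : ℕ))| ≤ q 2) →
      (Poly.eval y (lieDeriv (field β) P) : ℝ) ≤ m) :
    ∀ S : Fin 4 → ℤ → ℝ,
      (fun x : Fin 4 → Fin 3 → ℝ => (Poly.eval (L x) P : ℝ)) (fun i (j : Fin 3) => S i ((-1 : ℤ) + ((j : ℕ) : ℤ))) ≤ 0 →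
      (∀ (i : Fin 4) (k : ℤ), (k < (-1 : ℤ) ∨ (-1 : ℤ) + ((3 : ℕ) : ℤ) ≤ k) → |S i k| ≤ q k) →
      (∀ (i : Fin 4) (j : Fin 3), S i ((-1 : ℤ) + ((j : ℕ) : ℤ)) ^ 2 ≤ 2 * Φ i j) →
      0 < (fun x : Fin 4 → Fin 3 → ℝ => (Poly.eval (L x) G : ℝ)) (fun i (j : Fin 3) => S i ((-1 : ℤ) + ((j : ℕ) : ℤ))) →
      (fderiv ℝ (fun x : Fin 4 → Fin 3 → ℝ => (Poly.eval (L x) P : ℝ))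
          (fun i (j : Fin 3) => S i ((-1 : ℤ) + ((j : ℕ) : ℤ))))
        (fun i (j : Fin 3) => quadTerm 1 (fun a b c μ => α₀ a b c μ + (β : ℝ) * σ a b c μ)
          (fun i' k' (_ : ℝ) => S i' k') i ((-1 : ℤ) + ((j : ℕ) : ℤ)) 0) ≤ m :=
  decrease_box_of_sos τ α₀ τ' σ hτ hα₀ hτ' hσ β (field β) rfl point point_window point_below
    point_above point_twenty P G hP hG L hL hsos

end Pencil

end TriggerWindow

end Summit.NavierStokesRegularity.NavierStokesRegularity.Theorems
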